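import Summits.ResolutionOfSingularities.ResolutionOfSingularities.Theorems.FrobeniusClosingPatchingRelPerfectDepthCylinderCentreBookkeeping
import Summits.ResolutionOfSingularities.ResolutionOfSingularities.Theorems.FrobeniusClosingPatchingRelPerfectDepthWeightedSeqJBookkeeping
import Summits.ResolutionOfSingularities.ResolutionOfSingularities.Theorems.FrobeniusClosingPatchingRelPerfectDepthLocalMonomialSumGame
import HarnessLib

/-!
# Crux `PatchingRelPerfect` (stmt-ResolutionOfSingularities-16161), chain W5.2 — F7(β) d = 2: `MultiHostFormatB`, the
# GRAMMAR-AGNOSTIC X-side format «finitely many host × monomial summands over one snc member family» and its GENERIC STEP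
# along an arbitrary irreducible centre

[OURS · L1 W5.2 · F7(β) X-side · res-L1-w52-plan-1 NAMING G10-6 (3) 2026-08-27T14:33:26Z «res-D-pv-021 := `MultiHostFormatB`,
GRAMMAR-AGNOSTIC X-format of (β) d = 2 … GENERIC STEP along any irreducible closed regular W … K′ = controlledTransform τ 𝓘_W K ν
(= `controlledTransform_biSup_of_isGenericPoint` p538305) and `HasSNC 𝓔′`»; RULING G10-7 (f) «`MultiHostFormatB` is grammar-agnostic
and its generic `step` covers Phase C moves (any irreducible regular W)».]  Replaces the role of NO printed item; NOT a statement of the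
manuscript under review; fact-free.  AI-written; AI review is weaker than expert review.  OURS definitions (statement-lane rules:
no instances, no notation).

## Contents
* `MultiHostState X` — a COMMON member family `𝓔` with `HasSNC 𝓔` (in the application: `E′`, the N-carriers, the exceptional
  divisors) and finitely many summands `i : Fin n`, each a HOST ideal `host i` (`⊤` allowed: the pure N-summand) times the boundary
  monomial of an exponent list `exps i` with `boundaryOf (exps i) = 𝓔`; `MultiHostState.K S := ⨆ᵢ host i · monomialIdeal (exps i)`.
* `MultiHostState.step` — the successor state along a blowing up `τ` of an IRREDUCIBLE closed centre `W` having snc with `𝓔`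
  (`IsBlowup τ 𝓘_W`), with host orders `m i` and ONE weight `ν`: members `𝓔.map st ++ [F]`, hosts `τᶜ(host i, m i)`, exponent lists
  `(exps i).map (st × id) ++ [(F, m i + weightAt (exps i) η − ν)]` (`η` the generic point of `W`; members NOT containing `W` — e.g. `E′`
  for a cylinder centre — add nothing); `step_𝓔`, `step_host`, `step_exps` (rfl lemmas).
* **`MultiHostState.K_step`** — `(S.step …).K = controlledTransform τ 𝓘_W S.K ν` under `host i ≤ 𝓘_W ^ m i` and
  `ν ≤ m i + weightAt (exps i) η` for all `i` (p538305 `controlledTransform_biSup_of_isGenericPoint`): THE GENERIC STEP LAW; the three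
  E-constructors `inCons` / `cylCons` / `poleCons` of the (β) grammars are INSTANCES (choice of `W`) and are not in this file;
  `MultiHostState.comap_K_le_pow` — `τ^* K ≤ F^ν` (legality on `X′`, no separate hypothesis).
* `MultiHostState.IsEnd S` — the END predicate = VERBATIM the input of res-type-003's T7β-M `DepthTargets.LocalMonomialSumGame`
  (p539550, G10-6 (2)): `K = monomialSum 𝒦` for exponent lists `𝒦 ≠ []` on a member family `𝓕` with snc on an open `U ⊇ cosupp K`;
  `IsEnd.exists_centreSeq` — END ⇒ principalization of `K` by regular centres over the cosupport (`localMonomialSumGame_holds`).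

## References
* E. Bierstone, D. Grigoriev, P. Milman, J. Włodarczyk, *Effective Hironaka resolution and its complexity*, Asian J. Math. 15 (2011),
  Def. 3.1.3, Lemma 3.7.1 (1), §4 Step 2a. [BierstoneGrigorievMilmanWlodarczyk2011]
* J. Kollár, *Lectures on Resolution of Singularities* (2007), (3.111) Steps 1–3, Def. 3.25. [Kollar2007]
* U. Görtz, T. Wedhorn, *Algebraic Geometry I* (2nd ed., 2020), Prop. 13.91. [GortzWedhorn2020]
-/

-- `Summit.<Summit>.<Sub>.Theorems` with `Sub = Summit` (single-conjunct summit, D-0017)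
set_option linter.dupNamespace false

noncomputable section

open CategoryTheory AlgebraicGeometry TopologicalSpace
open Literature.AlgebraicGeometry.Resolution
open Literature.AlgebraicGeometry.Hironaka2017.MonomialPart
open Scheme.IdealSheafData

namespace Summit.ResolutionOfSingularities.ResolutionOfSingularities.Theorems.DepthMultiHost

universe u

/-- [OURS · L1 W5.2] **The multi-host X-side state** of the F7(β) depth-two member classes: a common member family `𝓔` with simple
normal crossings and `n` summands «host × boundary monomial», `K = ⨆ᵢ host i · monomialIdeal (exps i)`, every exponent list living
on `𝓔` (`boundaryOf (exps i) = 𝓔`). The pure N-summand is a summand with host `⊤`. Grammar-agnostic: no E-side data.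
[cite: BierstoneGrigorievMilmanWlodarczyk2011, Def. 3.1.3] -/
structure MultiHostState (X : Scheme.{u}) where
  /-- the common member family (E′, N-carriers, exceptional divisors, host-private divisors) -/
  𝓔 : List X.IdealSheafData
  /-- number of summands -/
  n : ℕ
  /-- the host ideal of summand `i` (`⊤` for the pure N-summand) -/
  host : Fin n → X.IdealSheafData
  /-- the exponent list of summand `i`, on the members `𝓔` -/
  exps : Fin n → List (X.IdealSheafData × ℕ)
  /-- the member family has simple normal crossings -/
  snc : HasSNC 𝓔
  /-- every exponent list lives on `𝓔` (same members, same order) -/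
  boundaryOf_exps : ∀ i, boundaryOf (exps i) = 𝓔

namespace MultiHostState

variable {X X' : Scheme.{u}}

/-- [OURS · L1 W5.2] **The ideal of the state**: `K = ⨆ᵢ host i · monomialIdeal (exps i)`. [cite: BierstoneGrigorievMilmanWlodarczyk2011, Def. 3.1.3] -/
def K (S : MultiHostState X) : X.IdealSheafData :=
  ⨆ i : Fin S.n, S.host i * monomialIdeal (S.exps i)

/-- The summand `i` is contained in `K`. [folklore] -/
theorem summand_le_K (S : MultiHostState X) (i : Fin S.n) : S.host i * monomialIdeal (S.exps i) ≤ S.K :=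
  le_iSup (fun i => S.host i * monomialIdeal (S.exps i)) i

/-- Every exponent list's boundary has simple normal crossings with any centre the member family has. [folklore] -/
theorem hasSNCWith_boundaryOf_exps (S : MultiHostState X) {C : X.IdealSheafData} (h : HasSNCWith S.𝓔 C) (i : Fin S.n) :
    HasSNCWith (boundaryOf (S.exps i)) C := by
  rw [S.boundaryOf_exps i]; exact h

/-- [OURS · L1 W5.2] **The generic step**: the successor state along a blowing up `τ : X′ → X` of the irreducible centre `W`
(`IsBlowup τ 𝓘_W`, `𝓔` snc with `𝓘_W`), host orders `m`, weight `ν`, exceptional exponents `m i + weightAt (exps i) η − ν` read at the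
generic point `η` of `W` (only members CONTAINING `W` count). Any irreducible regular `W` — cylinder centres and poles included.
[cite: Kollar2007, (3.111) Steps 1–3, Def. 3.25] [cite: BierstoneGrigorievMilmanWlodarczyk2011, Def. 3.1.3 (4)] -/
def step [IsLocallyNoetherian X] (S : MultiHostState X) (τ : X' ⟶ X) (W : Closeds X) (η : X) (m : Fin S.n → ℕ) (ν : ℕ)
    (hsnc : HasSNCWith S.𝓔 (vanishingIdeal W)) (hτ : IsBlowup τ (vanishingIdeal W)) : MultiHostState X' where
  𝓔 := S.𝓔.map (strictTransformIdeal τ (vanishingIdeal W)) ++ [(vanishingIdeal W).comap τ]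
  n := S.n
  host i := controlledTransform τ (vanishingIdeal W) (S.host i) (m i)
  exps i := ((S.exps i).map fun p => (strictTransformIdeal τ (vanishingIdeal W) p.1, p.2)) ++
    [((vanishingIdeal W).comap τ, m i + weightAt (S.exps i) η - ν)]
  snc := hsnc.hasSNC_transform hτ
  boundaryOf_exps i := by
    rw [DepthTargets.boundaryOf_map_strictTransform_append, S.boundaryOf_exps i]

section StepLemmas

variable [IsLocallyNoetherian X] (S : MultiHostState X) (τ : X' ⟶ X) (W : Closeds X) (η : X) (m : Fin S.n → ℕ) (ν : ℕ)
  (hsnc : HasSNCWith S.𝓔 (vanishingIdeal W)) (hτ : IsBlowup τ (vanishingIdeal W))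

/-- The members of the successor: strict transforms, then the exceptional divisor. [folklore] -/
theorem step_𝓔 : (S.step τ W η m ν hsnc hτ).𝓔 =
    S.𝓔.map (strictTransformIdeal τ (vanishingIdeal W)) ++ [(vanishingIdeal W).comap τ] := rfl

/-- The successor has the same number of summands. [folklore] -/
theorem step_n : (S.step τ W η m ν hsnc hτ).n = S.n := rfl

/-- The hosts of the successor: `τᶜ(host i, m i)`. [folklore] -/
theorem step_host (i : Fin S.n) :
    (S.step τ W η m ν hsnc hτ).host i = controlledTransform τ (vanishingIdeal W) (S.host i) (m i) := rfl

/-- The exponent lists of the successor. [folklore] -/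
theorem step_exps (i : Fin S.n) :
    (S.step τ W η m ν hsnc hτ).exps i =
      ((S.exps i).map fun p => (strictTransformIdeal τ (vanishingIdeal W) p.1, p.2)) ++
        [((vanishingIdeal W).comap τ, m i + weightAt (S.exps i) η - ν)] := rfl

/-- [OURS · L1 W5.2] **THE GENERIC STEP LAW `K′ = τᶜ(K, ν)`**: for the generic point `η` of `W`, host orders `host i ≤ 𝓘_W ^ m i` and one
weight `ν ≤ m i + weightAt (exps i) η` for every summand, the successor's ideal is the weight-`ν` controlled transform of `K` —
summand by summand p538305 (`controlledTransform_biSup_of_isGenericPoint`). [cite: BierstoneGrigorievMilmanWlodarczyk2011, Lemma 3.7.1 (1), §4 Step 2a]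
[cite: Kollar2007, (3.111) Steps 1–3] -/
theorem K_step (hη : IsGenericPoint η (W : Set X)) (hA : ∀ i, S.host i ≤ vanishingIdeal W ^ m i)
    (hν : ∀ i, ν ≤ m i + weightAt (S.exps i) η) :
    (S.step τ W η m ν hsnc hτ).K = controlledTransform τ (vanishingIdeal W) S.K ν := by
  have h := DepthCylinderCentre.controlledTransform_biSup_of_isGenericPoint (τ := τ) hη Finset.univ S.exps
    (fun i => S.host i * monomialIdeal (S.exps i)) S.host m (fun i _ => rfl) (fun i _ => hA i) (fun i _ => hν i)
    (fun i _ => S.hasSNCWith_boundaryOf_exps hsnc i) hτ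
  simp only [Finset.mem_univ, iSup_pos] at h
  unfold K
  rw [h]
  rfl

include hsnc hτ in
/-- **Legality on `X′`**: `τ^* K ≤ F^ν` under the same hypotheses (no separate hypothesis `K ≤ 𝓘_W^ν`). [cite: Kollar2007, (3.111) Step 1] -/
theorem comap_K_le_pow (hη : IsGenericPoint η (W : Set X)) (hA : ∀ i, S.host i ≤ vanishingIdeal W ^ m i)
    (hν : ∀ i, ν ≤ m i + weightAt (S.exps i) η) :
    S.K.comap τ ≤ (vanishingIdeal W).comap τ ^ ν := by
  rw [K, Scheme.IdealSheafData.comap_iSup]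
  exact iSup_le fun i => DepthCylinderCentre.comap_le_pow_of_isGenericPoint hη rfl (hA i) (hν i)
    (S.hasSNCWith_boundaryOf_exps hsnc i) hτ

/-- The step law in «total transform» form: `τ^* K = F^ν · K′`. [cite: BierstoneGrigorievMilmanWlodarczyk2011, Lemma 3.2.1] -/
theorem comap_K_eq_pow_mul_K_step (hη : IsGenericPoint η (W : Set X)) (hA : ∀ i, S.host i ≤ vanishingIdeal W ^ m i)
    (hν : ∀ i, ν ≤ m i + weightAt (S.exps i) η) :
    S.K.comap τ = (vanishingIdeal W).comap τ ^ ν * (S.step τ W η m ν hsnc hτ).K := by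
  rw [K_step S τ W η m ν hsnc hτ hη hA hν]
  exact (hτ.pow_mul_controlledTransform_eq (comap_K_le_pow S τ W η m ν hsnc hτ hη hA hν)).symm

end StepLemmas

/-- [OURS · L1 W5.2] **END of the multi-host game** (= VERBATIM the input of res-type-003's T7β-M `DepthTargets.LocalMonomialSumGame`,
p539550, res-L1-w52-plan-1 NAMING G10-6 (2)): `K` IS a finite sum of monomials `monomialSum 𝒦` in a member family `𝓕` (in the
application: drawn from `𝓔` and the hosts, redundant summands absorbed) that has simple normal crossings on an open `U` containing the
cosupport of `K`.  Global equality of ideals, snc only on `U` — exactly what T7β-M consumes (`IsEnd.exists_centreSeq`).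
[cite: BierstoneGrigorievMilmanWlodarczyk2011, Def. 3.1.3] [cite: Kollar2007, (3.111) Step 3] -/
def IsEnd (S : MultiHostState X) : Prop :=
  ∃ (U : X.Opens) (𝓕 : List X.IdealSheafData) (𝒦 : List (List (X.IdealSheafData × ℕ))),
    (∀ L ∈ 𝒦, boundaryOf L = 𝓕) ∧ 𝒦 ≠ [] ∧ HasSNC (𝓕.map fun F => F.comap U.ι) ∧
    (S.K.support : Set X) ⊆ (U : Set X) ∧ S.K = DepthTargets.monomialSum 𝒦

/-- **END ⇒ principalization** (T7β-M `DepthTargets.localMonomialSumGame_holds`, p539550): on a regular Noetherian `X`, an END state's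
`K` is principalized by a sequence of blowings up with regular centres over its cosupport, with regular top.
[cite: Kollar2007, (3.111) Step 3] [cite: GortzWedhorn2020, Prop. 13.91 (1)–(2)] -/
theorem IsEnd.exists_centreSeq [IsNoetherian X] (hX : Scheme.IsRegular X) {S : MultiHostState X} (h : S.IsEnd) :
    ∃ s : CentreSeq X, s.AllRegular ∧ s.CentresOver (S.K.support : Set X) ∧ Scheme.IsRegular s.top ∧
      IsLocallyPrincipal (S.K.comap s.comp) := by
  obtain ⟨U, 𝓕, 𝒦, h𝒦, hne, hsnc, hsupp, hK⟩ := h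
  rw [hK] at hsupp ⊢
  exact DepthTargets.localMonomialSumGame_holds X hX U 𝓕 𝒦 h𝒦 hne hsnc hsupp

end MultiHostState

end Summit.ResolutionOfSingularities.ResolutionOfSingularities.Theorems.DepthMultiHost

end
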